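import Literature.Probability.LatticeModels.LatticeGreenFiveSevenCertificate
import HarnessLib

/-!
# The lattice Green function of `ℤ³` at the origin (Watson's constant): `0.4902 ≤ R(3) ≤ 0.5094 < 0.51`,
# kernel-checked; Pólya's expected number of visits `1.4706 ≤ Σₙ P(Sₙ = 0) ≤ 1.528`

Topic `Probability/LatticeModels`; companion of `LatticeGreenFourCertificate.lean` (`R(4) < 5/16`) and
`LatticeGreenFiveSevenCertificate.lean` (`R(5) < 6/25`, `R(7) < 369/2324`), by the same method — the
Salmhofer–Seiler frame `sum_range_prob_zero_mem_Icc` (`d·R(d) = Σₙ P(Sₙ = 0)`, finitely many return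
probabilities of the simple random walk plus the heat-kernel tail of (A.7), Lemma A.4 sharpened to
`r(u) ≤ 0.43 u^{-1/2}` for `u ≥ 21`) — now in `d = 3`, where the constant is Watson's
`R(3) = (2π)⁻³ ∫_{[-π,π]³} d³k / Σ_μ(1 - cos k_μ) = 0.505462…` (G. N. Watson 1939; `3R(3) = 1.516386…` is
Pólya's expected number of visits of the simple random walk on `ℤ³` to its starting point, return probability
`1 − 1/(3R(3)) = 0.3405…`).

* `setIntegral_sum_cos_pow_one`, `setIntegral_sum_cos_pow_two` — the one- and two-coordinate moments
  `∫_{[-π,π]} cos^a = 2πκ(a)`, `∫_{[-π,π]²} (cos z₀ + cos z₁)^m = (2π)² k₂(m)` in the Brillouin-zone form used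
  by the peeling recursion `setIntegral_sum_cos_pow_succ`;
* `prob_three_eq_probThreeQ` — **`P(Sₙ = 0)` on `ℤ³` in closed form**, `3⁻ⁿ Σ_m binom(n,m) κ(n-m) k₂(m)`
  (peel `ℤ³ = ℤ × ℤ²`), as the cast of the computable rational `probThreeQ n`; `sum_range_prob_three_eq`;
* `cosMomentFastQ`, `probThreeFastQ`, `probThreeFastPartialQ` and `probThreeFastPartialQ_eq` — a
  kernel-cheap closed form of the same rationals (`κ(2b) = binom(2b,b)/4^b` through factorials instead of
  Wallis' recursion, odd terms short-circuited), PROVED equal to the analytic one; kernel evaluation at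
  `K = 210`: `1.4707982 ≤ Σ_{n<210} P(Sₙ = 0) ≤ 1.4707983` (`decide +kernel`, ≈ 45 s each on the farm);
* `integral_Ioi_srwHeatKernel_zero_pow_three_le` — the tail `∫_{70}^∞ r³ ≤ 0.43³ · 2/√70`;
* **`three_mul_latticeGreen_three_zero_le : 3·R(3) ≤ 1.528`**, `le_three_mul_latticeGreen_three_zero :
  1.4706 ≤ 3·R(3)`, **`latticeGreen_three_zero_lt : latticeGreen (0 : Site 3) < 51/100`**,
  `latticeGreen_three_zero_mem_Icc : 0.4902 ≤ R(3) ≤ 0.5094`, `tsum_prob_three_zero_mem_Icc`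
  (`1.4706 ≤ Σₙ P(Sₙ = 0) ≤ 1.528` on `ℤ³`).

Use (cell `pub/hubbard-tc`, MO-S3, interlayer grammar K4/K5): `latticeGreen (0 : Site 3)` is the ordering
threshold `J₀` of the Fröhlich–Simon–Spencer infrared bound for the classical XY model on `ℤ³`
(`AnisotropicPlaneRotatorLRO.lean`: plateau `≥ 1 − latticeGreen 0/J − ε`); with `R(3) < 0.51 < 2/π` the
isotropic comparison model ORDERS at `T = (π/2)·J` — the sibling rider `PlaneRotatorThreeDimOrderingFloor.lean`.
Honest framing: statements about the simple random walk on `ℤ³` / the massless lattice propagator only.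

## References

* M. Salmhofer, E. Seiler, Commun. Math. Phys. 139 (1991) 395–432: Appendix (A.7), Lemma A.4, and the table of
  `R(ν)` on p. 430. [SalmhoferSeiler1991]
* A. J. Guttmann, J. Phys. A 43 (2010) 305205, §2.1–§2.2 (the simple cubic lattice Green function; Watson's
  integral). [Guttmann2010]
* G. F. Lawler, V. Limic, *Random Walk: A Modern Introduction*, CUP 2010, §4.3. [LawlerLimic2010]
-/

noncomputable section

open MeasureTheory Set Filter Finset Real
open scoped Topology BigOperators Nat

namespace Literature.Probability.LatticeModels

variable {d : ℕ}

/-! ### Computable rational data -/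

/-- **`P(Sₙ = 0)` on `ℤ³` as a computable rational** (analytic form): `3⁻ⁿ Σ_m binom(n,m) κ(n-m) k₂(m)` (peel
one coordinate off `ℤ³ = ℤ × ℤ²`). [cite: Guttmann2010, §2.2] -/
def probThreeQ (n : ℕ) : ℚ :=
  sumBelow (fun m => binomQ n m * cosMomentQ (n - m) * twoCoordMomentQ m) (n + 1) / (3 : ℚ) ^ n

/-- Partial sums `Σ_{n<K} P(Sₙ = 0)` on `ℤ³`. [cite: Guttmann2010, §2.2] -/
def probThreePartialQ (K : ℕ) : ℚ := sumBelow probThreeQ K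

/-- **A kernel-cheap closed form of the cosine moments**: `κ(j) = binom(j, j/2)/4^{j/2}` for even `j`, `0` for
odd `j` (factorials instead of Wallis' recursion). [folklore] -/
def cosMomentFastQ (j : ℕ) : ℚ :=
  if j % 2 = 1 then 0 else binomQ j (j / 2) / (4 : ℚ) ^ (j / 2)

/-- The fast form of `P(Sₙ = 0)` on `ℤ³`: odd terms (which vanish) are short-circuited, `κ` in closed form.
[cite: Guttmann2010, §2.2] -/
def probThreeFastQ (n : ℕ) : ℚ :=
  sumBelow (fun m => if (n - m) % 2 = 1 ∨ m % 2 = 1 then 0 else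
    binomQ n m * cosMomentFastQ (n - m) * ((2 : ℚ) ^ m * cosMomentFastQ m * cosMomentFastQ m)) (n + 1) /
    (3 : ℚ) ^ n

/-- Partial sums of the fast form. [cite: Guttmann2010, §2.2] -/
def probThreeFastPartialQ (K : ℕ) : ℚ := sumBelow probThreeFastQ K

/-- `sumBelow f n = Σ_{i ∈ range n} f i`. [folklore] -/
private theorem sumBelow_eq_sum_range₃ (f : ℕ → ℚ) : ∀ n, sumBelow f n = ∑ i ∈ Finset.range n, f i
  | 0 => by simp [sumBelow]
  | (n + 1) => by rw [sumBelow, sumBelow_eq_sum_range₃ f n, Finset.sum_range_succ]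

/-- `binomQ n a = binom(n,a)` for `a ≤ n`. [folklore] -/
private theorem binomQ_eq_choose₃ {n a : ℕ} (h : a ≤ n) : binomQ n a = (n.choose a : ℚ) := by
  unfold binomQ
  have hfac : ((a ! * (n - a) ! : ℕ) : ℚ) ≠ 0 := by positivity
  rw [div_eq_iff hfac]
  have := Nat.choose_mul_factorial_mul_factorial h
  rw [← this]
  push_cast
  ring

/-- `κ(2b) = binom(2b,b)/4^b`. [folklore] -/
private theorem cosMomentQ_two_mul₃ : ∀ b : ℕ, cosMomentQ (2 * b) = (Nat.centralBinom b : ℚ) / 4 ^ b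
  | 0 => by simp [cosMomentQ]
  | (b + 1) => by
      have hrec : cosMomentQ (2 * (b + 1)) = cosMomentQ (2 * b) * ((2 * b + 1 : ℕ) : ℚ) /
          ((2 * b + 2 : ℕ) : ℚ) := by
        rw [show 2 * (b + 1) = 2 * b + 2 by ring]
        rfl
      rw [hrec, cosMomentQ_two_mul₃ b]
      have h := Nat.succ_mul_centralBinom_succ b
      have h' : ((b + 1 : ℕ) : ℚ) * (Nat.centralBinom (b + 1) : ℚ) =
          2 * (2 * b + 1) * (Nat.centralBinom b : ℚ) := by exact_mod_cast h
      push_cast at h' ⊢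
      have hb : ((b : ℚ) + 1) ≠ 0 := by positivity
      have hC : (Nat.centralBinom (b + 1) : ℚ) = 2 * (2 * b + 1) * Nat.centralBinom b / (b + 1) := by
        rw [eq_div_iff hb]
        linear_combination h'
      rw [hC]
      field_simp
      ring

/-- `κ(2b+1) = 0`. [folklore] -/
private theorem cosMomentQ_two_mul_add_one₃ : ∀ b : ℕ, cosMomentQ (2 * b + 1) = 0
  | 0 => by simp [cosMomentQ]
  | (b + 1) => by
      have hrec : cosMomentQ (2 * (b + 1) + 1) = cosMomentQ (2 * b + 1) * ((2 * b + 1 + 1 : ℕ) : ℚ) /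
          ((2 * b + 1 + 2 : ℕ) : ℚ) := by
        rw [show 2 * (b + 1) + 1 = 2 * b + 1 + 2 by ring]
        rfl
      rw [hrec, cosMomentQ_two_mul_add_one₃ b, zero_mul, zero_div]

/-- **The fast cosine moments are the cosine moments**: `cosMomentFastQ j = κ(j)`. [folklore] -/
private theorem cosMomentFastQ_eq (j : ℕ) : cosMomentFastQ j = cosMomentQ j := by
  unfold cosMomentFastQ
  obtain ⟨b, rfl | rfl⟩ := Nat.even_or_odd' j
  · rw [if_neg (by omega), show 2 * b / 2 = b by omega, cosMomentQ_two_mul₃ b,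
      binomQ_eq_choose₃ (by omega), Nat.centralBinom_eq_two_mul_choose]
  · rw [if_pos (by omega), cosMomentQ_two_mul_add_one₃]

/-- **The fast form equals the analytic form**: `probThreeFastQ n = probThreeQ n` (the short-circuited terms
vanish because `κ(odd) = 0`). [cite: Guttmann2010, §2.2] -/
theorem probThreeFastQ_eq (n : ℕ) : probThreeFastQ n = probThreeQ n := by
  unfold probThreeFastQ probThreeQ
  rw [sumBelow_eq_sum_range₃, sumBelow_eq_sum_range₃]
  congr 1
  refine Finset.sum_congr rfl fun m _ => ?_
  split_ifs with h
  · rcases h with h | h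
    · have hodd : Odd (n - m) := Nat.odd_iff.2 h
      obtain ⟨b, hb⟩ := hodd
      rw [hb, cosMomentQ_two_mul_add_one₃]; ring
    · have hodd : Odd m := Nat.odd_iff.2 h
      obtain ⟨b, hb⟩ := hodd
      unfold twoCoordMomentQ
      rw [hb, cosMomentQ_two_mul_add_one₃]; ring
  · rw [cosMomentFastQ_eq, cosMomentFastQ_eq]
    unfold twoCoordMomentQ
    ring

/-- `probThreeFastPartialQ K = probThreePartialQ K`. [cite: Guttmann2010, §2.2] -/
theorem probThreeFastPartialQ_eq (K : ℕ) : probThreeFastPartialQ K = probThreePartialQ K := by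
  unfold probThreeFastPartialQ probThreePartialQ
  rw [sumBelow_eq_sum_range₃, sumBelow_eq_sum_range₃]
  exact Finset.sum_congr rfl fun n _ => probThreeFastQ_eq n

/-! ### The kernel evaluation (`K = 210`) -/

/-- `Σ_{n<210} P(Sₙ = 0) ≤ 1.4707983` on `ℤ³` (exact rational evaluation by the kernel, fast form).
[cite: SalmhoferSeiler1991, p. 430 (table of R(ν))] -/
theorem probThreeFastPartialQ_210_le : probThreeFastPartialQ 210 ≤ 14707983 / 10000000 := by
  decide +kernel

/-- `1.4707982 ≤ Σ_{n<210} P(Sₙ = 0)` on `ℤ³`. [cite: SalmhoferSeiler1991, p. 430 (table of R(ν))] -/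
theorem le_probThreeFastPartialQ_210 : 14707982 / 10000000 ≤ probThreeFastPartialQ 210 := by
  decide +kernel

/-- The analytic partial sum at `K = 210`: `Σ_{n<210} P(Sₙ = 0) ≤ 1.4707983`.
[cite: SalmhoferSeiler1991, p. 430 (table of R(ν))] -/
theorem probThreePartialQ_210_le : probThreePartialQ 210 ≤ 14707983 / 10000000 := by
  rw [← probThreeFastPartialQ_eq]; exact probThreeFastPartialQ_210_le

/-- The analytic partial sum at `K = 210`: `1.4707982 ≤ Σ_{n<210} P(Sₙ = 0)`.
[cite: SalmhoferSeiler1991, p. 430 (table of R(ν))] -/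
theorem le_probThreePartialQ_210 : 14707982 / 10000000 ≤ probThreePartialQ 210 := by
  rw [← probThreeFastPartialQ_eq]; exact le_probThreeFastPartialQ_210

/-! ### The one- and two-coordinate moments on the Brillouin zone -/

/-- `∫_{[-π,π]¹} (Σ_{j<1} cos z_j)^a dz = 2π κ(a)` (Wallis). [cite: SalmhoferSeiler1991, Appendix (A.24)] -/
theorem setIntegral_sum_cos_pow_one (a : ℕ) :
    ∫ z in brillouin 1, (∑ j, Real.cos (z j)) ^ a = 2 * π * (cosMomentQ a : ℝ) := by
  have h : ∀ z : Fin 1 → ℝ, (∑ j, Real.cos (z j)) ^ a = ∏ j : Fin 1, Real.cos (z j) ^ a := by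
    intro z
    rw [Fin.sum_univ_one, Fin.prod_univ_one]
  simp_rw [h]
  rw [volume_restrict_brillouin 1,
    integral_fintype_prod_eq_prod (f := fun (_ : Fin 1) (k : ℝ) => Real.cos k ^ a), Fin.prod_univ_one]
  have hle : (-π : ℝ) ≤ π := by linarith [Real.pi_pos]
  rw [integral_Icc_eq_integral_Ioc, ← intervalIntegral.integral_of_le hle, intervalIntegral_cos_pow_eq]

/-- **`∫_{[-π,π]²} (cos z₀ + cos z₁)^m dz = (2π)² k₂(m)`** (peel once more, Wallis, and Vandermonde in the form
`sum_choose_mul_cosMomentQ`). [cite: Guttmann2010, §2.2 (square lattice: binom(2n,n)²)] -/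
theorem setIntegral_sum_cos_pow_two (m : ℕ) :
    ∫ z in brillouin 2, (∑ j, Real.cos (z j)) ^ m = (2 * π) ^ 2 * (twoCoordMomentQ m : ℝ) := by
  rw [setIntegral_sum_cos_pow_succ (d := 1) m]
  simp_rw [setIntegral_sum_cos_pow_one]
  rw [← sum_choose_mul_cosMomentQ m]
  push_cast
  rw [Finset.mul_sum]
  refine Finset.sum_congr rfl fun a _ => ?_
  ring

/-! ### The return probabilities on `ℤ³` in closed form -/

/-- **`P(Sₙ = 0)` on `ℤ³` in closed form**: `SRW.prob 3 n 0 = probThreeQ n = 3⁻ⁿ Σ_m binom(n,m) κ(n-m) k₂(m)`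
(Fourier formula `SRW.prob_eq_integral`, one coordinate peeled off `[-π,π]³`, the two-coordinate moment).
[cite: Guttmann2010, §2.1–§2.2] -/
theorem prob_three_eq_probThreeQ (n : ℕ) : SRW.prob 3 n 0 = (probThreeQ n : ℝ) := by
  rw [SRW.prob_eq_integral (by norm_num) n]
  have hpow : ∀ θ : Fin 3 → ℝ, (((3 : ℕ) : ℝ)⁻¹ * ∑ j, Real.cos (θ j)) ^ n =
      ((3 : ℝ) ^ n)⁻¹ * (∑ j, Real.cos (θ j)) ^ n := fun θ => by
    rw [mul_pow, Nat.cast_ofNat, inv_pow]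
  simp_rw [hpow]
  rw [integral_const_mul, setIntegral_sum_cos_pow_succ (d := 2) n]
  simp_rw [setIntegral_sum_cos_pow_two]
  unfold probThreeQ
  rw [sumBelow_eq_sum_range₃]
  push_cast
  simp only [Finset.sum_div, Finset.mul_sum]
  refine Finset.sum_congr rfl fun m hm => ?_
  rw [binomQ_eq_choose₃ (Nat.lt_succ_iff.1 (Finset.mem_range.1 hm))]
  push_cast
  have h2π : (2 * π : ℝ) ≠ 0 := by positivity
  have h3 : (3 : ℝ) ^ n ≠ 0 := by positivity
  field_simp

/-- `Σ_{n<K} P(Sₙ = 0) = probThreePartialQ K` on `ℤ³`. [cite: Guttmann2010, §2.2] -/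
theorem sum_range_prob_three_eq (K : ℕ) :
    ∑ n ∈ Finset.range K, SRW.prob 3 n 0 = (probThreePartialQ K : ℝ) := by
  unfold probThreePartialQ
  rw [sumBelow_eq_sum_range₃]
  push_cast
  exact Finset.sum_congr rfl fun n _ => prob_three_eq_probThreeQ n

/-! ### The tail of (A.7) in `ν = 3` beyond `u = 70` -/

/-- `r(u)³ ≤ 0.43³ · u^{-3/2}` for `u ≥ 21`. [cite: SalmhoferSeiler1991, Lemma A.4 (A.22)] -/
private theorem srwHeatKernel_zero_pow_three_le {u : ℝ} (hu : 21 ≤ u) :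
    srwHeatKernel u 0 ^ 3 ≤ (43 / 100) ^ 3 * u ^ (-(3 / 2 : ℝ)) := by
  have hu0 : 0 < u := by linarith
  have h := pow_le_pow_left₀ (srwHeatKernel_zero_nonneg u) (srwHeatKernel_zero_le_of_le hu) 3
  rw [div_pow] at h
  refine h.trans (le_of_eq ?_)
  rw [div_eq_mul_inv]
  congr 1
  rw [Real.sqrt_eq_rpow, ← Real.rpow_natCast, ← Real.rpow_mul hu0.le, ← Real.rpow_neg hu0.le]
  norm_num

/-- `∫_{c}^∞ u^{-3/2} du = 2/√c` (`c > 0`), with integrability. [folklore] -/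
private theorem integral_Ioi_rpow_neg_three_halves {c : ℝ} (hc : 0 < c) :
    IntegrableOn (fun u : ℝ => u ^ (-(3 / 2 : ℝ))) (Ioi c) ∧
      ∫ u in Ioi c, u ^ (-(3 / 2 : ℝ)) = 2 / Real.sqrt c := by
  refine ⟨integrableOn_Ioi_rpow_of_lt (by norm_num) hc, ?_⟩
  rw [integral_Ioi_rpow_of_lt (by norm_num) hc]
  have h1 : (-(3 / 2 : ℝ)) + 1 = -(1 / 2 : ℝ) := by norm_num
  rw [h1, Real.rpow_neg hc.le, ← Real.sqrt_eq_rpow]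
  field_simp

/-- **The tail of (A.7) in `ν = 3` beyond `u = 70`**: `∫_{70}^∞ r(u)³ du ≤ 0.43³ · 2/√70 (≤ 0.0191)`.
[cite: SalmhoferSeiler1991, Appendix (A.7), Lemma A.4] -/
theorem integral_Ioi_srwHeatKernel_zero_pow_three_le :
    ∫ u in Ioi (70 : ℝ), srwHeatKernel u 0 ^ 3 ≤ (43 / 100 : ℝ) ^ 3 * (2 / Real.sqrt 70) := by
  have hc : (0 : ℝ) < 70 := by norm_num
  obtain ⟨hint, -⟩ := setIntegral_exp_mul_inv_dispersion_eq (d := 3) le_rfl hc.le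
  obtain ⟨hmaj0, hval0⟩ := integral_Ioi_rpow_neg_three_halves hc
  have hmaj := hmaj0.const_mul ((43 / 100 : ℝ) ^ 3)
  have hle : ∫ u in Ioi (70 : ℝ), srwHeatKernel u 0 ^ 3 ≤
      ∫ u in Ioi (70 : ℝ), (43 / 100 : ℝ) ^ 3 * u ^ (-(3 / 2 : ℝ)) :=
    setIntegral_mono_on hint hmaj measurableSet_Ioi fun u hu =>
      srwHeatKernel_zero_pow_three_le ((show (21 : ℝ) ≤ 70 by norm_num).trans (le_of_lt hu))
  rwa [integral_const_mul, hval0] at hle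

/-! ### The certificate: `0.4902 ≤ R(3) ≤ 0.5094 < 0.51` -/

/-- `8.366 ≤ √70` and hence `(√70)⁻¹ ≤ 1/8.366`. [folklore] -/
private theorem inv_sqrt_seventy_le : (Real.sqrt 70)⁻¹ ≤ 1 / 8.366 := by
  have hs : (8.366 : ℝ) ≤ Real.sqrt 70 := Real.le_sqrt_of_sq_le (by norm_num)
  rw [one_div]; exact (inv_le_inv₀ (by positivity) (by norm_num)).2 hs

/-- **`3 R(3) ≤ 1.528`**: `3·latticeGreen 0 ≤ Σ_{n<210} P(Sₙ=0) + 3∫_{70}^∞ r³ + r(70)³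
≤ 1.4707983 + 0.43³(6/√70 + (70√70)⁻¹) ≤ 1.52796` (true value `1.516386`, Pólya–Watson).
[cite: SalmhoferSeiler1991, Appendix (A.7), Lemma A.4 and p. 430] -/
theorem three_mul_latticeGreen_three_zero_le : 3 * latticeGreen (0 : Site 3) ≤ 1528 / 1000 := by
  have hIcc := (sum_range_prob_zero_mem_Icc (d := 3) le_rfl 210).1
  have h70 : ((210 : ℕ) : ℝ) / ((3 : ℕ) : ℝ) = 70 := by norm_num
  rw [h70, sum_range_prob_three_eq] at hIcc
  have hP : ((probThreePartialQ 210 : ℚ) : ℝ) ≤ 14707983 / 10000000 := by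
    have h := (Rat.cast_le (K := ℝ)).2 probThreePartialQ_210_le
    push_cast at h
    exact h
  have hT := integral_Ioi_srwHeatKernel_zero_pow_three_le
  have hr : srwHeatKernel 70 0 ^ 3 ≤ (43 / 100) ^ 3 * (70 : ℝ) ^ (-(3 / 2 : ℝ)) :=
    srwHeatKernel_zero_pow_three_le (by norm_num)
  have hrpow : (70 : ℝ) ^ (-(3 / 2 : ℝ)) = (70 * Real.sqrt 70)⁻¹ := by
    rw [Real.sqrt_eq_rpow, Real.rpow_neg (by norm_num), ← Real.rpow_one_add' (by norm_num) (by norm_num)]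
    norm_num
  rw [hrpow] at hr
  have hs := inv_sqrt_seventy_le
  have hs0 : 0 < Real.sqrt 70 := Real.sqrt_pos.2 (by norm_num)
  have hT' : ∫ u in Ioi (70 : ℝ), srwHeatKernel u 0 ^ 3 ≤ (43 / 100 : ℝ) ^ 3 * (2 * (1 / 8.366)) := by
    refine hT.trans (mul_le_mul_of_nonneg_left ?_ (by norm_num))
    rw [div_eq_mul_inv]; exact mul_le_mul_of_nonneg_left hs zero_le_two
  have hr' : srwHeatKernel 70 0 ^ 3 ≤ (43 / 100) ^ 3 * ((70 : ℝ)⁻¹ * (1 / 8.366)) := by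
    refine hr.trans (mul_le_mul_of_nonneg_left ?_ (by norm_num))
    rw [mul_inv]; exact mul_le_mul_of_nonneg_left hs (by norm_num)
  push_cast at hIcc
  nlinarith

/-- **`1.4706 ≤ 3 R(3)`**: `Σ_{n<210} P(Sₙ=0) − r(70)³ ≤ 3·latticeGreen 0`.
[cite: SalmhoferSeiler1991, Appendix (A.7), Lemma A.4 and p. 430] -/
theorem le_three_mul_latticeGreen_three_zero : 14706 / 10000 ≤ 3 * latticeGreen (0 : Site 3) := by
  have hIcc := (sum_range_prob_zero_mem_Icc (d := 3) le_rfl 210).2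
  have h70 : ((210 : ℕ) : ℝ) / ((3 : ℕ) : ℝ) = 70 := by norm_num
  rw [h70, sum_range_prob_three_eq] at hIcc
  have hP : (14707982 / 10000000 : ℝ) ≤ ((probThreePartialQ 210 : ℚ) : ℝ) := by
    have h := (Rat.cast_le (K := ℝ)).2 le_probThreePartialQ_210
    push_cast at h
    exact h
  have hr : srwHeatKernel 70 0 ^ 3 ≤ (43 / 100) ^ 3 * (70 : ℝ) ^ (-(3 / 2 : ℝ)) :=
    srwHeatKernel_zero_pow_three_le (by norm_num)
  have hrpow : (70 : ℝ) ^ (-(3 / 2 : ℝ)) = (70 * Real.sqrt 70)⁻¹ := by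
    rw [Real.sqrt_eq_rpow, Real.rpow_neg (by norm_num), ← Real.rpow_one_add' (by norm_num) (by norm_num)]
    norm_num
  rw [hrpow] at hr
  have hs := inv_sqrt_seventy_le
  have hr' : srwHeatKernel 70 0 ^ 3 ≤ (43 / 100) ^ 3 * ((70 : ℝ)⁻¹ * (1 / 8.366)) := by
    refine hr.trans (mul_le_mul_of_nonneg_left ?_ (by norm_num))
    rw [mul_inv]; exact mul_le_mul_of_nonneg_left hs (by norm_num)
  push_cast at hIcc
  nlinarith

/-- **`R(3) = latticeGreen 0 < 0.51`** on `ℤ³` (Watson's `0.505462…`), kernel-checked.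
[cite: SalmhoferSeiler1991, Appendix (A.7) and p. 430; Guttmann2010, §2.1] -/
theorem latticeGreen_three_zero_lt : latticeGreen (0 : Site 3) < 51 / 100 := by
  linarith [three_mul_latticeGreen_three_zero_le]

/-- **`0.4902 ≤ R(3) ≤ 0.5094`** (true value `0.505462`). [cite: Guttmann2010, §2.1 (Watson's integral)] -/
theorem latticeGreen_three_zero_mem_Icc :
    (4902 / 10000 : ℝ) ≤ latticeGreen (0 : Site 3) ∧ latticeGreen (0 : Site 3) ≤ 5094 / 10000 := by
  constructor
  · linarith [le_three_mul_latticeGreen_three_zero]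
  · linarith [three_mul_latticeGreen_three_zero_le]

/-- **Pólya's expected number of visits, enclosed**: on `ℤ³`, `1.4706 ≤ Σₙ P(Sₙ = 0) = 3·R(3) ≤ 1.528` (true
`1.516386`; the return probability `1 − 1/Σ` thus lies in `[0.32, 0.3456]`, Pólya's `0.3405…`).
[cite: LawlerLimic2010, §4.3] -/
theorem tsum_prob_three_zero_mem_Icc :
    (14706 / 10000 : ℝ) ≤ ∑' n, SRW.prob 3 n 0 ∧ ∑' n, SRW.prob 3 n 0 ≤ 1528 / 1000 := by
  rw [(hasSum_prob_zero (d := 3) le_rfl).tsum_eq]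
  push_cast
  exact ⟨le_three_mul_latticeGreen_three_zero, three_mul_latticeGreen_three_zero_le⟩

end Literature.Probability.LatticeModels

end
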